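import Literature.Topology.FourManifolds.MazurDouble
import Literature.Topology.FourManifolds.Handles
import Literature.Topology.FourManifolds.Gluing
import Literature.Topology.FourManifolds.DoubleThickening
import Literature.Topology.FourManifolds.ClosedBall
import Literature.Topology.FourManifolds.CorkDecomposition
import Literature.Topology.FourManifolds.MorseProofs
import Literature.Topology.FourManifolds.PresentationHandlebodyFive
import Literature.Topology.FourManifolds.PresentationHandlebodyFiveContractibleProofs
import Mathlib.Geometry.Manifold.Diffeomorph
import HarnessLib

/-!
# Mazur doubles, II: reduction of Mazur's theorem to a counted thickening and rank-one Andrews–Curtis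

Companion of `MazurDouble.lean` (the named fact `Mazur1961_double_sphere_four`: the double of a compact
contractible `(1,1,1)`-handlebody — a Mazur manifold — is `S⁴`; Mazur 1961, Aitchison–Rubinstein 1984
Lemma 5.4).  This file REDUCES that fact to inputs the tree already names or spells out, following
Mazur's 5-dimensional proof (`W × I ≅ B⁵`, `D(W) = ∂(W × I)`):

* (T⁺) `exists_countedThickening_of_isDouble` — the tree's named fact `exists_thickening_of_isDouble`
  (`DoubleThickening.lean`, FGMW 2010 proof of Fact 2, Kirby 1989 p. 18) STRENGTHENED to carry the
  handle COUNTS of `W` over to `W × I` (the printed proof gives them: `f + t²` has the critical points of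
  `f` with the same indices); `exists_thickening_of_isDouble_of_counted : (T⁺) → (T)`;
* `isStablyAndrewsCurtisEquivalent_trivial_of_rank_one` — PROVED: on one generator every balanced
  presentation `⟨x ∣ xⁿ⟩` of the trivial group has `n = ±1` and is Andrews–Curtis trivial;
* `nonempty_diffeomorph_closedBall_of_hasHandleDecomposition_oneOneOne_five` — a compact contractible
  5-manifold with a `(1,1,1)` handle decomposition is `𝔻⁵`, given (B), (VK) (the two spelled-out inputs of
  `IsPresentationHandlebodyFive.exists_of_contractibleSpace_of_parts`, verbatim) and the EXISTING named
  fact (AC) `IsPresentationHandlebodyFive.nonempty_diffeomorph_closedBall_of_isStablyAndrewsCurtisEquivalent`;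
* `Mazur1961_double_sphere_four_of_facts : (T⁺) → (B) → (VK) → (AC) → Mazur1961_double_sphere_four`.

Wanted by the SPC4 crux `ConvexBisection.AcyclicBisectionRigidity` (item stmt-SmoothPoincare4-10507, line
seam-duality-cancellation, stub `stub_mazurDouble`, which is PROVED modulo `Mazur1961_double_sphere_four`).
Written by the line's wave-1 stub-worker (lead a1-1), kernel-checked.

## References

* B. Mazur, *A note on some contractible 4-manifolds*, Ann. of Math. 73 (1961), 221–228. [Mazur1961]
* I. R. Aitchison, J. H. Rubinstein, *Fibered knots and involutions on homotopy spheres*, Contemp. Math. 35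
  (1984), Lemma 5.4. [AitchisonRubinstein1984]
* M. Freedman, R. Gompf, S. Morrison, K. Walker, *Man and machine thinking about the smooth 4-dimensional
  Poincaré conjecture*, Quantum Topol. 1 (2010), proof of Fact 2. [FreedmanGompfMorrisonWalker2010]
* R. Kirby, *The topology of 4-manifolds*, LNM 1374 (1989), Ch. I §2 and p. 18. [Kirby1989]
* J. J. Andrews, M. L. Curtis, *Free groups and handlebodies*, Proc. AMS 16 (1965). [AndrewsCurtis1965]
-/

noncomputable section

open scoped Manifold ContDiff Topology ContinuousMap
open Set Function

namespace Literature.Topology.FourManifolds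

/-! ## The counted thickening fact (T⁺) -/

/-- **The double of a compact manifold with boundary bounds its thickening `W × [0, 1]`, a
handlebody with the SAME HANDLE COUNTS** — the tree's named fact
`Literature.Topology.FourManifolds.exists_thickening_of_isDouble` (`DoubleThickening.lean`) with the
index bound `IsHandlebodyOfIndexLE` replaced by the full count `HasHandleDecomposition … c`, which is
what the printed proofs give: for a compact smooth `(n+1)`-manifold with boundary `W` (Hausdorff,
second countable, model `𝓡∂ (n + 1)`) with an adapted Morse function `f` with `c k` critical points
of index `k`, the product `V = W × [0, 1]` with its corners `∂W × {0, 1}` straightened is a compact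
smooth `(n+2)`-manifold with boundary, `V ≃ₕ W`, the stabilised function `f + t²` (after the standard
boundary adjustment) is adapted to `∂V` with the same critical points and the same indices — so
`HasHandleDecomposition (n + 1) V c` (Freedman–Gompf–Morrison–Walker 2010, proof of Fact 2: *"The
handle structure on `B'` stabilizes to a handle structure on `B' × I` also with `k` 1-handles and `k`
2-handles"*; Kirby 1989, Ch. I p. 18: `Σ₀ × I`, *"attaching circles are unknotted and unlinked in
`S⁴ = ∂B⁵`"*) — and `∂V = W × {0} ∪ ∂W × I ∪ W × {1}` is the double `D(W)`: every Hausdorff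
second-countable smooth `P` with `IsDouble b (𝓡 (n + 1)) P` embeds onto `∂V` (gluing uniqueness,
`nonempty_diffeomorph_of_isBoundaryGluing`; Kosinski 1993, VI §5).  Universe `0`, shape of
`exists_thickening_of_isDouble`. [cite: FreedmanGompfMorrisonWalker2010, proof of Fact 2]
[cite: Kirby1989, Ch. I §2 (Lemma 2.2) and p. 18] [cite: Kosinski1993, VI §5]
-/
def exists_countedThickening_of_isDouble : Prop :=
  ∀ (n : ℕ) (c : ℕ → ℕ) (W : Type) [TopologicalSpace W] [T2Space W] [SecondCountableTopology W]
    [ChartedSpace (EuclideanHalfSpace (n + 1)) W] [IsManifold (𝓡∂ (n + 1)) ∞ W] [CompactSpace W],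
    HasHandleDecomposition n W c →
    ∀ (b : BoundaryData (𝓡∂ (n + 1)) W (𝓡 n))
      (P : Type) [TopologicalSpace P] [T2Space P] [SecondCountableTopology P]
      [ChartedSpace (EuclideanSpace ℝ (Fin (n + 1))) P] [IsManifold (𝓡 (n + 1)) ∞ P],
    IsDouble b (𝓡 (n + 1)) P →
    ∃ (V : Type) (_ : TopologicalSpace V) (_ : T2Space V) (_ : SecondCountableTopology V)
      (_ : ChartedSpace (EuclideanHalfSpace (n + 1 + 1)) V)
      (_ : IsManifold (𝓡∂ (n + 1 + 1)) ∞ V) (_ : CompactSpace V),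
      Nonempty (V ≃ₕ W) ∧ HasHandleDecomposition (n + 1) V c ∧
      ∃ φ : P → V, Manifold.IsSmoothEmbedding (𝓡 (n + 1)) (𝓡∂ (n + 1 + 1)) ∞ φ ∧
        Set.range φ = (𝓡∂ (n + 1 + 1)).boundary V

/-- (T⁺) refines the tree's (T): the counted thickening fact implies
`Literature.Topology.FourManifolds.exists_thickening_of_isDouble` (forget the counts above the bound;
finiteness of the critical set, `IsMorse.finite_criticalSet_holds`). [cite: FreedmanGompfMorrisonWalker2010, proof of Fact 2] -/
theorem exists_thickening_of_isDouble_of_counted (hT : exists_countedThickening_of_isDouble) :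
    exists_thickening_of_isDouble := by
  intro n k W _ _ _ _ _ _ hW b P _ _ _ _ _ hD
  obtain ⟨f, hf, hidx⟩ := hW
  obtain ⟨V, i₁, i₂, i₃, i₄, i₅, i₆, hVW, hVc, hφ⟩ :=
    hT n (fun j => (criticalSetOfIndex (𝓡∂ (n + 1)) f j).ncard) W ⟨f, hf, fun _ => rfl⟩ b P hD
  refine ⟨V, i₁, i₂, i₃, i₄, i₅, i₆, hVW, ?_, hφ⟩
  obtain ⟨g, hg, hgc⟩ := hVc
  refine ⟨g, hg, fun z hz => ?_⟩
  by_contra hlt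
  rw [not_le] at hlt
  -- no critical point of `f` has index `morseIndex g z > k`, so the count there is `0`
  have hWfin : (criticalSetOfIndex (𝓡∂ (n + 1)) f (morseIndex (𝓡∂ (n + 1 + 1)) g z)).Finite :=
    (IsMorse.finite_criticalSet_holds hf.isMorse).subset (criticalSetOfIndex_subset _ f _)
  have hWempty : criticalSetOfIndex (𝓡∂ (n + 1)) f (morseIndex (𝓡∂ (n + 1 + 1)) g z) = ∅ := by
    ext x
    simp only [mem_criticalSetOfIndex, mem_empty_iff_false, iff_false, not_and]
    intro hx hxk
    have := hidx x hx
    omega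
  have hVfin : (criticalSetOfIndex (𝓡∂ (n + 1 + 1)) g (morseIndex (𝓡∂ (n + 1 + 1)) g z)).Finite :=
    (IsMorse.finite_criticalSet_holds hg.isMorse).subset (criticalSetOfIndex_subset _ g _)
  have h0 : (criticalSetOfIndex (𝓡∂ (n + 1 + 1)) g (morseIndex (𝓡∂ (n + 1 + 1)) g z)).ncard = 0 := by
    rw [hgc]
    exact (congrArg Set.ncard hWempty).trans (Set.ncard_empty _)
  rw [Set.ncard_eq_zero hVfin] at h0
  have hzmem : z ∈ criticalSetOfIndex (𝓡∂ (n + 1 + 1)) g (morseIndex (𝓡∂ (n + 1 + 1)) g z) :=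
    ⟨hz, rfl⟩
  rw [h0] at hzmem
  exact hzmem

/-! ## Rank one: every balanced presentation `⟨x ∣ xⁿ⟩` of the trivial group is Andrews–Curtis trivial -/

/-- Every element of `F₁ = FreeGroup (Fin 1)` is a power of the generator `t = of 0`. [folklore] -/
private theorem freeGroup_one_exists_zpow (x : FreeGroup (Fin 1)) :
    ∃ n : ℤ, (FreeGroup.of 0) ^ n = x := by
  -- adapted from `ShadowApproximation.Negative.freeGroup_one_exists_zpow`
  -- (Summits/SmoothPoincare4/SmoothPoincare4/Theorems/ShadowApproximation/Negative/LevelSymmetriesFalse.lean)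
  have hr : Set.range (FreeGroup.of : Fin 1 → FreeGroup (Fin 1)) = {FreeGroup.of 0} := by
    ext y
    simp only [Set.mem_range, Set.mem_singleton_iff]
    constructor
    · rintro ⟨i, rfl⟩; rw [Fin.eq_zero i]
    · rintro rfl; exact ⟨0, rfl⟩
  have hx : x ∈ Subgroup.zpowers (FreeGroup.of 0 : FreeGroup (Fin 1)) := by
    rw [Subgroup.zpowers_eq_closure, ← hr, FreeGroup.closure_range_of]
    trivial
  exact Subgroup.mem_zpowers_iff.1 hx

/-- **On one generator, a balanced presentation of the trivial group is Andrews–Curtis trivial.**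
If `P = ⟨x ∣ w⟩` presents the trivial group then `w = xⁿ` with `n = ±1` (map `F₁ → ℤ`: the normal
closure of `w` maps onto `nℤ`, which is `ℤ` only for `n = ±1`), so `P` is the trivial presentation
`⟨x ∣ x⟩` or one inversion move away from it (`AndrewsCurtisMove.inv`); no stabilisation is needed.
(Andrews–Curtis 1965; the case "≤ 1 generator is trivial" of the tree's item
`TwoGeneratorPresentationSpheres`.) [cite: AndrewsCurtis1965, Theorem] -/
theorem isStablyAndrewsCurtisEquivalent_trivial_of_rank_one {m : ℕ} (hm : m = 1)
    (P : BalancedPresentation m) (hP : P.PresentsTrivialGroup) :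
    IsStablyAndrewsCurtisEquivalent P (BalancedPresentation.trivial m) := by
  subst hm
  obtain ⟨n, hn⟩ := freeGroup_one_exists_zpow (P 0)
  -- the exponent is `±1`
  have hunit : n = 1 ∨ n = -1 := by
    rw [BalancedPresentation.presentsTrivialGroup_iff_normalClosure_eq_top] at hP
    let τ : FreeGroup (Fin 1) →* Multiplicative ℤ :=
      FreeGroup.lift fun _ => Multiplicative.ofAdd (1 : ℤ)
    have hτt : τ (FreeGroup.of 0) = Multiplicative.ofAdd (1 : ℤ) := FreeGroup.lift_apply_of
    have hτ : Function.Surjective τ := by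
      intro z
      refine ⟨FreeGroup.of 0 ^ (Multiplicative.toAdd z), ?_⟩
      rw [map_zpow, hτt, ← ofAdd_zsmul, smul_eq_mul, mul_one, ofAdd_toAdd]
    have hsub : τ '' Set.range P ⊆
        (Subgroup.zpowers (Multiplicative.ofAdd n) : Subgroup (Multiplicative ℤ)) := by
      rintro _ ⟨_, ⟨i, rfl⟩, rfl⟩
      rw [Fin.eq_zero i, ← hn, map_zpow, hτt, ← ofAdd_zsmul, smul_eq_mul, mul_one]
      exact Subgroup.mem_zpowers _
    have htop : Subgroup.normalClosure (τ '' Set.range P) = ⊤ := by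
      rw [← Subgroup.map_normalClosure _ _ hτ, hP, Subgroup.map_top_of_surjective _ hτ]
    have hle : (⊤ : Subgroup (Multiplicative ℤ)) ≤ Subgroup.zpowers (Multiplicative.ofAdd n) := by
      rw [← htop]
      exact Subgroup.normalClosure_le_normal hsub
    have h1 : Multiplicative.ofAdd (1 : ℤ) ∈ Subgroup.zpowers (Multiplicative.ofAdd n) :=
      hle (Subgroup.mem_top _)
    obtain ⟨k, hk⟩ := Subgroup.mem_zpowers_iff.1 h1
    rw [← ofAdd_zsmul, smul_eq_mul] at hk
    have hkn : k * n = 1 := Multiplicative.ofAdd.injective hk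
    exact Int.eq_one_or_neg_one_of_mul_eq_one (by rwa [mul_comm] at hkn)
  refine ⟨0, ?_⟩
  simp only [BalancedPresentation.stabilizeBy_zero]
  rcases hunit with rfl | rfl
  · -- `P = ⟨x ∣ x⟩`
    have hPeq : P = BalancedPresentation.trivial 1 := by
      funext i
      rw [Fin.eq_zero i, ← hn, zpow_one]
      rfl
    rw [hPeq]
    exact Relation.EqvGen.refl _
  · -- `P = ⟨x ∣ x⁻¹⟩`, one inversion away from `⟨x ∣ x⟩`
    have hPeq : P = Function.update (BalancedPresentation.trivial 1) 0
        ((BalancedPresentation.trivial 1) 0)⁻¹ := by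
      funext i
      rw [Fin.eq_zero i, Function.update_self, ← hn, zpow_neg, zpow_one]
      rfl
    have hmove : AndrewsCurtisMove (BalancedPresentation.trivial 1) P := by
      rw [hPeq]
      exact AndrewsCurtisMove.inv _ 0
    exact Relation.EqvGen.symm _ _ (Relation.EqvGen.rel _ _ hmove)

/-! ## Mazur's theorem from (T⁺), (B), (VK), (AC) -/

/-- **A compact contractible `5`-manifold with a handle decomposition into one `0`-, one `1`- and
one `2`-handle is the `5`-ball**, GIVEN (B) the level-with-counts input and (VK) the van Kampen input
of `IsPresentationHandlebodyFive.exists_of_contractibleSpace_of_parts` (verbatim its hypotheses) and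
(AC) the Andrews–Curtis fact
`IsPresentationHandlebodyFive.nonempty_diffeomorph_closedBall_of_isStablyAndrewsCurtisEquivalent`.
Proof: the adapted Morse function has indices `≤ 2` (finite critical set, zero counts above `2`);
(B) presents `V` as its `(1,1)`-level `V₁` (connected: `IsMultiAttachment.preconnectedSpace_of_preconnectedSpace`;
orientable: `isOrientable_of_simplyConnectedSpace_holds`) with ONE `2`-handle attached; (VK) and
`IsPresentationHandlebodyFive.exists_of_isMultiAttachment` read off a balanced presentation of the
trivial group on one generator with `IsPresentationHandlebodyFive P V`; it is Andrews–Curtis trivial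
(`isStablyAndrewsCurtisEquivalent_trivial_of_rank_one`), so (AC) gives `V ≅ 𝔻⁵`.  This is Mazur's
`W × I ≅ B⁵` / the rank-one case of Kirby 1989, p. 18. [cite: Kirby1989, Ch. I, p. 18]
[cite: AndrewsCurtis1965, Theorem] -/
theorem nonempty_diffeomorph_closedBall_of_hasHandleDecomposition_oneOneOne_five
    (hB : ∀ (W' : Type) [TopologicalSpace W'] [T2Space W'] [SecondCountableTopology W']
      [ChartedSpace (EuclideanHalfSpace (4 + 1)) W'] [IsManifold (𝓡∂ (4 + 1)) ∞ W']
      [CompactSpace W'] (f : W' → ℝ), IsMorseAdapted (𝓡∂ (4 + 1)) f →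
      (∀ z, IsMCriticalPt (𝓡∂ (4 + 1)) f z → morseIndex (𝓡∂ (4 + 1)) f z ≤ 2) →
      ∃ (V : Type) (_ : TopologicalSpace V) (_ : T2Space V) (_ : SecondCountableTopology V)
        (_ : ChartedSpace (EuclideanHalfSpace (4 + 1)) V) (_ : IsManifold (𝓡∂ (4 + 1)) ∞ V)
        (_ : CompactSpace V) (g : V → ℝ)
        (h : Fin (criticalSetOfIndex (𝓡∂ (4 + 1)) f 2).ncard → HandleAttachingMap 4 2 V),
        IsMorseAdapted (𝓡∂ (4 + 1)) g ∧
        (criticalSetOfIndex (𝓡∂ (4 + 1)) g 0).ncard =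
          (criticalSetOfIndex (𝓡∂ (4 + 1)) f 0).ncard ∧
        (criticalSetOfIndex (𝓡∂ (4 + 1)) g 1).ncard =
          (criticalSetOfIndex (𝓡∂ (4 + 1)) f 1).ncard ∧
        (∀ z, IsMCriticalPt (𝓡∂ (4 + 1)) g z → morseIndex (𝓡∂ (4 + 1)) g z ≤ 1) ∧
        (IsOrientable (𝓡∂ (4 + 1)) W' → IsOrientable (𝓡∂ (4 + 1)) V) ∧
        HandleAttachingMap.IsMultiAttachment h (𝓡∂ (4 + 1)) W')
    (hVK : ∀ (V : Type) [TopologicalSpace V] [T2Space V] [SecondCountableTopology V]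
      [CompactSpace V] [ConnectedSpace V] [ChartedSpace (EuclideanHalfSpace (4 + 1)) V]
      [IsManifold (𝓡∂ (4 + 1)) ∞ V] (r : ℕ) (h : Fin r → HandleAttachingMap 4 2 V)
      (W : Type) [TopologicalSpace W] [T2Space W] [SecondCountableTopology W]
      [ChartedSpace (EuclideanHalfSpace (4 + 1)) W] [IsManifold (𝓡∂ (4 + 1)) ∞ W]
      [CompactSpace W],
      HandleAttachingMap.IsMultiAttachment h (𝓡∂ (4 + 1)) W → SimplyConnectedSpace W →
      ∀ (v : V) (g : Fin r → FundamentalGroup V v), (∀ j, (h j).RepresentsClass (g j)) →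
        Subgroup.normalClosure (Set.range g) = ⊤)
    (hAC : IsPresentationHandlebodyFive.nonempty_diffeomorph_closedBall_of_isStablyAndrewsCurtisEquivalent)
    (W : Type) [TopologicalSpace W] [T2Space W] [SecondCountableTopology W]
    [ChartedSpace (EuclideanHalfSpace (4 + 1)) W] [IsManifold (𝓡∂ (4 + 1)) ∞ W] [CompactSpace W]
    [ContractibleSpace W] (hW : HasHandleDecomposition 4 W (fun k => if k ≤ 2 then 1 else 0)) :
    Nonempty (W ≃ₘ⟮𝓡∂ (4 + 1), 𝓡∂ (4 + 1)⟯
      Metric.closedBall (0 : EuclideanSpace ℝ (Fin (4 + 1))) 1) := by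
  obtain ⟨f, hf, hcount⟩ := hW
  have hfin : ∀ k, (criticalSetOfIndex (𝓡∂ (4 + 1)) f k).Finite := fun k =>
    (IsMorse.finite_criticalSet_holds hf.isMorse).subset (criticalSetOfIndex_subset _ f k)
  -- indices `≤ 2`
  have hidx : ∀ z, IsMCriticalPt (𝓡∂ (4 + 1)) f z → morseIndex (𝓡∂ (4 + 1)) f z ≤ 2 := by
    intro z hz
    by_contra hlt
    have h0 : (criticalSetOfIndex (𝓡∂ (4 + 1)) f (morseIndex (𝓡∂ (4 + 1)) f z)).ncard = 0 := by
      rw [hcount]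
      exact if_neg hlt
    rw [Set.ncard_eq_zero (hfin _)] at h0
    have hzmem : z ∈ criticalSetOfIndex (𝓡∂ (4 + 1)) f (morseIndex (𝓡∂ (4 + 1)) f z) := ⟨hz, rfl⟩
    rw [h0] at hzmem
    exact hzmem
  have hf0 : (criticalSetOfIndex (𝓡∂ (4 + 1)) f 0).ncard = 1 := by rw [hcount]; rfl
  have hf1 : (criticalSetOfIndex (𝓡∂ (4 + 1)) f 1).ncard = 1 := by rw [hcount]; rfl
  have hf2 : (criticalSetOfIndex (𝓡∂ (4 + 1)) f 2).ncard = 1 := by rw [hcount]; rfl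
  -- (B): the `(1,1)`-level below the `2`-handle, and `W = V ∪ h²`
  obtain ⟨V, _, _, _, _, _, _, g, h, hg, hg0, hg1, hgidx, hor, hVW⟩ := hB W f hf hidx
  haveI : Nonempty V := by
    obtain ⟨p, -⟩ := Set.nonempty_of_ncard_ne_zero
      (s := criticalSetOfIndex (𝓡∂ (4 + 1)) g 0) (by rw [hg0, hf0]; exact one_ne_zero)
    exact ⟨p⟩
  haveI : PreconnectedSpace V := hVW.preconnectedSpace_of_preconnectedSpace
  haveI : ConnectedSpace V := ⟨‹Nonempty V›⟩
  have hWor : IsOrientable (𝓡∂ (4 + 1)) W := isOrientable_of_simplyConnectedSpace_holds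
  have hgfin : ∀ k, (criticalSetOfIndex (𝓡∂ (4 + 1)) g k).Finite := fun k =>
    (IsMorse.finite_criticalSet_holds hg.isMorse).subset (criticalSetOfIndex_subset _ g k)
  have hV : HasHandleDecomposition 4 V
      (handleCount 1 (criticalSetOfIndex (𝓡∂ (4 + 1)) f 2).ncard) := by
    -- adapted from `IsPresentationHandlebodyFive.exists_of_contractibleSpace_of_parts`
    -- (Literature/Topology/FourManifolds/PresentationHandlebodyFiveContractibleProofs.lean)
    refine ⟨g, hg, fun k => ?_⟩
    rcases Nat.lt_or_ge k 2 with hk | hk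
    · interval_cases k
      · simpa [handleCount] using hg0.trans hf0
      · simpa [handleCount] using hg1.trans (hf1.trans hf2.symm)
    · simp only [handleCount, show k ≠ 0 by omega, show k ≠ 1 by omega, if_false]
      rw [Set.ncard_eq_zero (hgfin k)]
      ext z
      simp only [mem_criticalSetOfIndex, mem_empty_iff_false, iff_false, not_and]
      intro hz hzk
      have := hgidx z hz
      omega
  -- (VK) + Kosinski VII §7: a balanced presentation of the trivial group on ONE generator
  obtain ⟨Q, hQ, hQW⟩ := IsPresentationHandlebodyFive.exists_of_isMultiAttachment (hor hWor) hV h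
    hVW (hVK V _ h W hVW inferInstance)
  -- rank one ⇒ Andrews–Curtis trivial ⇒ (AC)
  exact hAC _ Q W hQW (isStablyAndrewsCurtisEquivalent_trivial_of_rank_one hf2 Q hQ)

/-- **Mazur's theorem from the tree-shaped inputs (T⁺), (B), (VK), (AC).**  For a Mazur manifold
`W` (compact contractible, `HasHandleDecomposition 3 W (1,1,1,0,…)`) and a double `P` of `W`:
(T⁺) gives the thickening `V ⊇ ∂V ≅ P`, `V ≃ₕ W` contractible with `HasHandleDecomposition 4 V (1,1,1,0,…)`;
`nonempty_diffeomorph_closedBall_of_hasHandleDecomposition_oneOneOne_five` gives `V ≅ 𝔻⁵`; the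
boundary datum `(P, φ)` of `V` restricts this diffeomorphism to `P ≅ ∂𝔻⁵ = S⁴`
(`BoundaryData.restrictDiffeomorph`, `closedBallBoundaryData 4`).
[cite: Mazur1961, Theorem (W × I ≅ I⁵) and its Corollary (2W ≅ S⁴)] [cite: Kirby1989, Ch. I, p. 18] -/
theorem Mazur1961_double_sphere_four_of_facts (hT : exists_countedThickening_of_isDouble)
    (hB : ∀ (W' : Type) [TopologicalSpace W'] [T2Space W'] [SecondCountableTopology W']
      [ChartedSpace (EuclideanHalfSpace (4 + 1)) W'] [IsManifold (𝓡∂ (4 + 1)) ∞ W']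
      [CompactSpace W'] (f : W' → ℝ), IsMorseAdapted (𝓡∂ (4 + 1)) f →
      (∀ z, IsMCriticalPt (𝓡∂ (4 + 1)) f z → morseIndex (𝓡∂ (4 + 1)) f z ≤ 2) →
      ∃ (V : Type) (_ : TopologicalSpace V) (_ : T2Space V) (_ : SecondCountableTopology V)
        (_ : ChartedSpace (EuclideanHalfSpace (4 + 1)) V) (_ : IsManifold (𝓡∂ (4 + 1)) ∞ V)
        (_ : CompactSpace V) (g : V → ℝ)
        (h : Fin (criticalSetOfIndex (𝓡∂ (4 + 1)) f 2).ncard → HandleAttachingMap 4 2 V),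
        IsMorseAdapted (𝓡∂ (4 + 1)) g ∧
        (criticalSetOfIndex (𝓡∂ (4 + 1)) g 0).ncard =
          (criticalSetOfIndex (𝓡∂ (4 + 1)) f 0).ncard ∧
        (criticalSetOfIndex (𝓡∂ (4 + 1)) g 1).ncard =
          (criticalSetOfIndex (𝓡∂ (4 + 1)) f 1).ncard ∧
        (∀ z, IsMCriticalPt (𝓡∂ (4 + 1)) g z → morseIndex (𝓡∂ (4 + 1)) g z ≤ 1) ∧
        (IsOrientable (𝓡∂ (4 + 1)) W' → IsOrientable (𝓡∂ (4 + 1)) V) ∧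
        HandleAttachingMap.IsMultiAttachment h (𝓡∂ (4 + 1)) W')
    (hVK : ∀ (V : Type) [TopologicalSpace V] [T2Space V] [SecondCountableTopology V]
      [CompactSpace V] [ConnectedSpace V] [ChartedSpace (EuclideanHalfSpace (4 + 1)) V]
      [IsManifold (𝓡∂ (4 + 1)) ∞ V] (r : ℕ) (h : Fin r → HandleAttachingMap 4 2 V)
      (W : Type) [TopologicalSpace W] [T2Space W] [SecondCountableTopology W]
      [ChartedSpace (EuclideanHalfSpace (4 + 1)) W] [IsManifold (𝓡∂ (4 + 1)) ∞ W]
      [CompactSpace W],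
      HandleAttachingMap.IsMultiAttachment h (𝓡∂ (4 + 1)) W → SimplyConnectedSpace W →
      ∀ (v : V) (g : Fin r → FundamentalGroup V v), (∀ j, (h j).RepresentsClass (g j)) →
        Subgroup.normalClosure (Set.range g) = ⊤)
    (hAC : IsPresentationHandlebodyFive.nonempty_diffeomorph_closedBall_of_isStablyAndrewsCurtisEquivalent) :
    Mazur1961_double_sphere_four := by
  intro W _ _ _ _ _ _ _ hW b P _ _ _ _ _ hD
  -- (T⁺): `V = W × I`, `∂V ≅ P`, counts `(1,1,1,0,…)`, `V ≃ₕ W` contractible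
  obtain ⟨V, _, _, _, _, _, _, ⟨e⟩, hVc, φ, hφ, hφr⟩ :=
    hT 3 (fun k => if k ≤ 2 then 1 else 0) W hW b P hD
  haveI : ContractibleSpace V := e.contractibleSpace
  -- `V ≅ 𝔻⁵`
  obtain ⟨Φ⟩ := nonempty_diffeomorph_closedBall_of_hasHandleDecomposition_oneOneOne_five hB hVK hAC
    V hVc
  -- restrict to the boundary: `P ≅ ∂𝔻⁵ = S⁴`
  let bP : BoundaryData (𝓡∂ (4 + 1)) V (𝓡 4) :=
    { carrier := P, incl := φ, isSmoothEmbedding := hφ, range_incl := hφr }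
  exact ⟨bP.restrictDiffeomorph (closedBallBoundaryData 4) Φ⟩

end Literature.Topology.FourManifolds

end
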